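import Summits.ResolutionOfSingularities.ResolutionOfSingularities.Theorems.MarkedTransferCampaignW24ReducedRunImmortalFive
import HarnessLib

/-!
# «EVERY POLYNOMIAL UNIVERSAL RUN DIES» IS `p`-DEPENDENT — the sentence of res-L1-type-o6's `p = 2` theorem
# `univRun_eventually_zero_coe` is FALSE at `p = 5` and at `p = 7`, stated in the same shape (polynomials `P : K[X]` coerced
# to `K⟦X⟧`)
# (HIRONAKA-L, kernel record in the OURS reduced model of slot W2.4 / RD-2′ (`CampaignW24.ReducedRun`); res-type-059 g14;
# consumes `…ReducedRunImmortalSeven.lean` / `…ReducedRunImmortalFive.lean`)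

**HONEST FRAMING.** OURS throughout: kernel theorems about the one-variable reduced model (`univRun`,
`MarkedTransferCampaignW24ReducedRunUniversal.lean`, res-D-pv-035 AS res-L1-k24). Nothing below is a statement of [Hironaka2017]
(lit key `paper:url-3343fd9e678b`), nothing asserts that any statement of it holds, nothing is a claim about resolution of
singularities in characteristic `p`; the manuscript stays «under review» (D-0012/D-0089). AI work, weaker than expert review.

## What is proved (`K` any field of the stated characteristic)
* `coe_witness_five` / `coe_witness_seven`: the polynomials `3X + X² + X³ + X⁷ ∈ K[X]` (`p = 5`) and `5X + 6X² + 5X³ + 5X⁴ + 2X⁵`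
  (`p = 7`) coerce to the digit-list series of `…ImmortalFive` / `…ImmortalSeven`.
* **`exists_polynomial_univRun_ne_zero_five` / `_seven`**: `∃ P : K[X], P.coeff 0 = 0 ∧ ∀ N, univRun ↑P N ≠ 0`.
* **`not_forall_polynomial_univRun_eventually_zero_five` / `_seven`**: `¬ ∀ P : K[X], ∃ N, univRun ↑P N = 0` — the negation of
  the SHAPE of `univRun_eventually_zero_coe` (which holds at `p = 2`). So the reduced-slice residual «UnivRunDies» of
  ⟨`Rescue.FiniteSupportStaysInBox_ours`⟩ (res-rescue-typ-2 FINDING 2026-08-27T10:21:26Z) is a theorem at `p = 2`, refuted at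
  `p = 5, 7`; the immortal witnesses are nevertheless exhausted in box at every depth (`canonRun_five_eq_zero`,
  `canonRun_seven_eq_zero`), so they do NOT bear against the binder itself. OURS objects only.
Hypotheses: `[CharP K 5]` resp. `[CharP K 7]`; no FACT-LIST fact, no DEFECT binder; no new definitions. Standard axioms.
-/

noncomputable section

set_option linter.dupNamespace false -- mandated namespace of this single-conjunct summit

namespace Summit.ResolutionOfSingularities.ResolutionOfSingularities.Theorems

namespace CampaignW24

namespace ReducedRun

open PowerSeries

universe u

section Five

variable {K : Type u} [Field K] [CharP K 5]

omit [CharP K 5] in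
/-- The `p = 5` witness as a polynomial: `↑(3X + X² + X³ + X⁷) = ofList [0,3,1,1,0,0,0,1]`. [folklore] -/
theorem coe_witness_five :
    (((Polynomial.C 3 * Polynomial.X + Polynomial.X ^ 2 + Polynomial.X ^ 3 + Polynomial.X ^ 7 : Polynomial K)) : K⟦X⟧) =
      ofList [0, 3, 1, 1, 0, 0, 0, 1] := by
  ext n
  rw [Polynomial.coeff_coe, coeff_ofList]
  simp only [Polynomial.coeff_add, Polynomial.coeff_C_mul, Polynomial.coeff_X_pow, Polynomial.coeff_X]
  rcases n with _ | _ | _ | _ | _ | _ | _ | _ | n <;> simp [lget]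

/-- **A polynomial with an immortal universal run, `p = 5`**: `P = 3X + X² + X³ + X⁷` (`P(0) = 0`). [folklore] -/
theorem exists_polynomial_univRun_ne_zero_five :
    ∃ P : Polynomial K, P.coeff 0 = 0 ∧ ∀ N : ℕ, univRun (P : K⟦X⟧) N ≠ 0 :=
  ⟨Polynomial.C 3 * Polynomial.X + Polynomial.X ^ 2 + Polynomial.X ^ 3 + Polynomial.X ^ 7, by simp, fun N => by
    rw [coe_witness_five]; exact univRun_ne_zero_carrier_five N⟩

/-- **«Every polynomial universal run dies» FAILS at `p = 5`** (the shape of the `p = 2` theorem `univRun_eventually_zero_coe`,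
negated). OURS (reduced model). [folklore] -/
theorem not_forall_polynomial_univRun_eventually_zero_five :
    ¬ ∀ P : Polynomial K, ∃ N : ℕ, univRun (P : K⟦X⟧) N = 0 := by
  intro h
  obtain ⟨P, -, hP⟩ := exists_polynomial_univRun_ne_zero_five (K := K)
  obtain ⟨N, hN⟩ := h P
  exact hP N hN

end Five

section Seven

variable {K : Type u} [Field K] [CharP K 7]

omit [CharP K 7] in
/-- The `p = 7` witness as a polynomial: `↑(5X + 6X² + 5X³ + 5X⁴ + 2X⁵) = ofList [0,5,6,5,5,2]`. [folklore] -/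
theorem coe_witness_seven :
    (((Polynomial.C 5 * Polynomial.X + Polynomial.C 6 * Polynomial.X ^ 2 + Polynomial.C 5 * Polynomial.X ^ 3 +
        Polynomial.C 5 * Polynomial.X ^ 4 + Polynomial.C 2 * Polynomial.X ^ 5 : Polynomial K)) : K⟦X⟧) =
      ofList [0, 5, 6, 5, 5, 2] := by
  ext n
  rw [Polynomial.coeff_coe, coeff_ofList]
  simp only [Polynomial.coeff_add, Polynomial.coeff_C_mul, Polynomial.coeff_X_pow, Polynomial.coeff_X]
  rcases n with _ | _ | _ | _ | _ | _ | n <;> simp [lget]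

/-- **A polynomial with an immortal universal run, `p = 7`**: `P = 5X + 6X² + 5X³ + 5X⁴ + 2X⁵` (`P(0) = 0`). [folklore] -/
theorem exists_polynomial_univRun_ne_zero_seven :
    ∃ P : Polynomial K, P.coeff 0 = 0 ∧ ∀ N : ℕ, univRun (P : K⟦X⟧) N ≠ 0 :=
  ⟨Polynomial.C 5 * Polynomial.X + Polynomial.C 6 * Polynomial.X ^ 2 + Polynomial.C 5 * Polynomial.X ^ 3 +
      Polynomial.C 5 * Polynomial.X ^ 4 + Polynomial.C 2 * Polynomial.X ^ 5, by simp, fun N => by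
    rw [coe_witness_seven]; exact univRun_ne_zero_carrier_seven N⟩

/-- **«Every polynomial universal run dies» FAILS at `p = 7`** (the shape of the `p = 2` theorem `univRun_eventually_zero_coe`,
negated). OURS (reduced model). [folklore] -/
theorem not_forall_polynomial_univRun_eventually_zero_seven :
    ¬ ∀ P : Polynomial K, ∃ N : ℕ, univRun (P : K⟦X⟧) N = 0 := by
  intro h
  obtain ⟨P, -, hP⟩ := exists_polynomial_univRun_ne_zero_seven (K := K)
  obtain ⟨N, hN⟩ := h P
  exact hP N hN

end Seven

end ReducedRun

end CampaignW24

end Summit.ResolutionOfSingularities.ResolutionOfSingularities.Theorems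

end
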